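import Literature.Topology.FourManifolds.GroupTrisections
import Literature.GroupTheory.CombinatorialGroupTheory.NielsenGeneratingTuplesNormalForm
import Mathlib.GroupTheory.QuotientGroup.Basic
import HarnessLib

/-!
# Stub `stub_trisectionPairPrimitives_succ` of line `finitary-ac-central-residue` for crux
`CongruenceShadows.ShadowsStandard` (item stmt-SmoothPoincare4-14593, route
route-SmoothPoincare4-CongruenceShadows)

**Two primitives in the kernel — the trisection pair `(N 0, K 2)`, genus `≥ 6`.** With
`S = SurfaceGroup (3 + 3(n+1))` and `N = s4Kernels.stabilizeIter (n+1)` the standard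
genus-`3(n+2)` trisection of `S⁴`, let `K = (N 0, N 1, K 2)` be a `(3+3(n+1); n+2)` group
trisection of the trivial group normalised in its first two slots. Then the free group
`S ⧸ K 2 ≅ F_{3(n+2)}` has a free basis two of whose (distinct) members lie in the image of `N 0`.

Proof.
* `free_quotient 2` gives `e₀ : FreeGroup (Fin g) ≃* S ⧸ K 2` (`g = 3 + 3(n+1)`), and
  `free_pairQuotient 0 2` gives `e₁ : FreeGroup (Fin k) ≃* S ⧸ P` with
  `P = ⟪K 0 ∪ K 2⟫ = K 0 ⊔ K 2` (`k = n+2`).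
* The projection `S ⧸ K 2 ↠ S ⧸ P` conjugated by `e₀, e₁` is an epimorphism
  `ψ : FreeGroup (Fin g) ↠ FreeGroup (Fin k)`, i.e. the tuple `u = (ψ xᵢ)ᵢ` generates `F_k`.
* **Nielsen's normal form of generating tuples** (Lyndon–Schupp, Ch. I Prop. 2.7; the tree's
  `Literature.GroupTheory.CombinatorialGroupTheory.exists_mulAut_lift_apply_eq_basis`): for the
  injection `e : Fin k → Fin g`, `x ↦ x + 2`, some automorphism `ε` of `FreeGroup (Fin g)` has
  `ψ (ε xᵢ) = 1` for every `i ∉ range e`, in particular for `i = 0, 1`.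
* The basis `ε ≫ e₀` of `S ⧸ K 2` has its members `0 ≠ 1` in `ker (S ⧸ K 2 ↠ S ⧸ P)`, which is
  the image of `P = K 0 ⊔ K 2`, i.e. the image of `K 0 = N 0`.

The file declares theorems only.
-/

-- the prescribed namespace `Summit.<P>.<Sub>.…` duplicates `SmoothPoincare4` (P = Sub)
set_option linter.dupNamespace false

noncomputable section

namespace Summit.SmoothPoincare4.SmoothPoincare4.Theorems.ShadowsStandard.FinitaryAcCentralResidue

open Literature.Topology.FourManifolds
open Subgroup
open _root_.Literature.GroupTheory.CombinatorialGroupTheory (exists_mulAut_lift_apply_eq_basis)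

/-! ## Two members of a basis in the kernel of an epimorphism of free groups -/

/-- **Kernel of an epimorphism of free groups of finite rank contains two members of a basis**
(Lyndon–Schupp, Ch. I Prop. 2.7, through the tree's Nielsen normal form of generating tuples):
if `ψ : FreeGroup (Fin g) →* FreeGroup (Fin k)` is surjective and `k + 2 ≤ g`, some
automorphism `ε` of `FreeGroup (Fin g)` has `ψ (ε x₀) = ψ (ε x₁) = 1`. -/
theorem exists_mulAut_two_mem_ker {g k : ℕ} (hkg : k + 2 ≤ g)
    (ψ : FreeGroup (Fin g) →* FreeGroup (Fin k)) (hψ : Function.Surjective ψ) :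
    ∃ ε : MulAut (FreeGroup (Fin g)),
      ψ (ε (FreeGroup.of ⟨0, by omega⟩)) = 1 ∧ ψ (ε (FreeGroup.of ⟨1, by omega⟩)) = 1 := by
  -- the tuple `u = (ψ xᵢ)ᵢ` generates
  set u : Fin g → FreeGroup (Fin k) := fun i => ψ (FreeGroup.of i) with hu
  have hlift : FreeGroup.lift u = ψ := FreeGroup.ext_hom _ _ fun i => by simp [hu]
  have hgen : Subgroup.closure (Set.range u) = ⊤ := by
    rw [← FreeGroup.range_lift_eq_closure, MonoidHom.range_eq_top, hlift]
    exact hψ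
  -- the injection `x ↦ x + 2` misses `0` and `1`
  set e : Fin k → Fin g := fun x => ⟨x.val + 2, by omega⟩ with he
  have hinj : Function.Injective e := by
    intro x y hxy
    simp only [he, Fin.mk.injEq] at hxy
    exact Fin.ext (by omega)
  have hmiss : ∀ i : Fin g, i.val < 2 → i ∉ Set.range e := by
    rintro i hi ⟨x, hx⟩
    rw [← hx] at hi
    simp only [he] at hi
    omega
  obtain ⟨ε, -, hε⟩ := exists_mulAut_lift_apply_eq_basis u hgen e hinj
  refine ⟨ε, ?_, ?_⟩
  · have := hε ⟨0, by omega⟩ (hmiss _ (by simp))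
    rwa [hlift] at this
  · have := hε ⟨1, by omega⟩ (hmiss _ (by simp))
    rwa [hlift] at this

/-! ## The stub -/

/-- **Stub `stub_trisectionPairPrimitives_succ`.** For a `(3+3(n+1); n+2)` group trisection `K`
of the trivial group with `K 0 = N 0` and `K 1 = N 1` (`N = s4Kernels.stabilizeIter (n+1)`), the
free group `S ⧸ K 2 ≅ F_{3(n+2)}` has a free basis two of whose (distinct) members lie in the
image of `N 0`: the image of `N 0` in `S ⧸ K 2` is the kernel of the epimorphism
`S ⧸ K 2 ↠ S ⧸ ⟪K 0 ∪ K 2⟫ ≅ F_{n+2}` (`free_pairQuotient 0 2`), and an epimorphism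
`F_{3(n+2)} ↠ F_{n+2}` kills two members of some basis (`exists_mulAut_two_mem_ker`, Nielsen's
normal form of generating tuples, Lyndon–Schupp Ch. I Prop. 2.7). -/
theorem stub_trisectionPairPrimitives_succ :
    ∀ (n : ℕ) (K : TrisectionKernels (3 + 3 * (n + 1))) [(K 2).Normal],
      IsGroupTrisection (3 + 3 * (n + 1)) (n + 1 + 1) (PUnit : Type) K →
      K 0 = s4Kernels.stabilizeIter (n + 1) 0 → K 1 = s4Kernels.stabilizeIter (n + 1) 1 →
      ∃ (ι : Type) (_ : Fintype ι) (_ : DecidableEq ι)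
        (e : FreeGroup ι ≃* SurfaceGroup (3 + 3 * (n + 1)) ⧸ K 2) (a b : ι), a ≠ b ∧
        e (FreeGroup.of a) ∈ (s4Kernels.stabilizeIter (n + 1) 0).map (QuotientGroup.mk' (K 2)) ∧
        e (FreeGroup.of b) ∈ (s4Kernels.stabilizeIter (n + 1) 0).map (QuotientGroup.mk' (K 2)) := by
  intro n K _ hK h0 h1
  haveI : (K 0).Normal := hK.normal 0
  -- `F_g ≅ S ⧸ K 2`
  obtain ⟨e₀'⟩ := hK.free_quotient 2
  obtain ⟨e₀⟩ : Nonempty (FreeGroup (Fin (3 + 3 * (n + 1))) ≃* SurfaceGroup (3 + 3 * (n + 1)) ⧸ K 2) :=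
    ⟨e₀'.trans (QuotientGroup.quotientMulEquivOfEq (normalClosure_eq_self (K 2)))⟩
  -- `F_k ≅ S ⧸ P`, `P = ⟪K 0 ∪ K 2⟫ = K 0 ⊔ K 2`
  set P : Subgroup (SurfaceGroup (3 + 3 * (n + 1))) :=
    normalClosure ((K 0 : Set (SurfaceGroup (3 + 3 * (n + 1)))) ∪ K 2) with hP
  obtain ⟨e₁⟩ := hK.free_pairQuotient 0 2 (by decide)
  change FreeGroup (Fin (n + 1 + 1)) ≃* SurfaceGroup (3 + 3 * (n + 1)) ⧸ P at e₁
  have hPsup : P = K 0 ⊔ K 2 :=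
    le_antisymm
      (normalClosure_le_normal
        (Set.union_subset (fun _ hx => mem_sup_left hx) (fun _ hx => mem_sup_right hx)))
      (sup_le (fun _ hx => subset_normalClosure (Set.mem_union_left _ hx))
        (fun _ hx => subset_normalClosure (Set.mem_union_right _ hx)))
  -- the projection `S ⧸ K 2 ↠ S ⧸ P`
  have hle : K 2 ≤ (QuotientGroup.mk' P).ker := by
    rw [QuotientGroup.ker_mk', hPsup]
    exact le_sup_right
  set φ : SurfaceGroup (3 + 3 * (n + 1)) ⧸ K 2 →* SurfaceGroup (3 + 3 * (n + 1)) ⧸ P :=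
    QuotientGroup.lift (K 2) (QuotientGroup.mk' P) hle with hφ
  -- its conjugate `ψ : F_g ↠ F_k`
  set ψ : FreeGroup (Fin (3 + 3 * (n + 1))) →* FreeGroup (Fin (n + 1 + 1)) :=
    e₁.symm.toMonoidHom.comp (φ.comp e₀.toMonoidHom) with hψ
  have hφsurj : Function.Surjective φ := by
    intro q
    obtain ⟨s, rfl⟩ := QuotientGroup.mk_surjective q
    exact ⟨QuotientGroup.mk s, by rw [hφ, QuotientGroup.lift_mk, QuotientGroup.mk'_apply]⟩
  have hψsurj : Function.Surjective ψ :=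
    e₁.symm.surjective.comp (hφsurj.comp e₀.surjective)
  -- elements killed by `ψ` land in the image of `N 0`
  have hmem : ∀ x : FreeGroup (Fin (3 + 3 * (n + 1))), ψ x = 1 →
      e₀ x ∈ (s4Kernels.stabilizeIter (n + 1) 0).map (QuotientGroup.mk' (K 2)) := by
    intro x hx
    rw [hψ, MonoidHom.comp_apply, MulEquiv.coe_toMonoidHom, MulEquiv.map_eq_one_iff,
      MonoidHom.comp_apply, MulEquiv.coe_toMonoidHom] at hx
    obtain ⟨s, hs⟩ := QuotientGroup.mk_surjective (e₀ x)
    rw [← hs, hφ, QuotientGroup.lift_mk, QuotientGroup.mk'_apply, QuotientGroup.eq_one_iff] at hx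
    have h := mem_map_of_mem (QuotientGroup.mk' (K 2)) hx
    rw [hPsup, Subgroup.map_sup, (map_eq_bot_iff (K 2)).2 (QuotientGroup.ker_mk' (K 2)).ge,
      sup_bot_eq, h0] at h
    rw [← hs]
    exact h
  -- Nielsen
  obtain ⟨ε, hε0, hε1⟩ := exists_mulAut_two_mem_ker (by omega) ψ hψsurj
  exact ⟨Fin (3 + 3 * (n + 1)), inferInstance, inferInstance, ε.trans e₀, ⟨0, by omega⟩,
    ⟨1, by omega⟩, by simp, hmem _ hε0, hmem _ hε1⟩

end Summit.SmoothPoincare4.SmoothPoincare4.Theorems.ShadowsStandard.FinitaryAcCentralResidue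

end
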